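import Literature.AlgebraicGeometry.ShimuraVarieties.UnitaryCurveConjugateSliceDescends        -- ★ p850264 (LA4-p03): `lift_comp_sliceComplexOfSlice_fst` (a complexified `E`-slice reads `f`); re-exports ★ p849947∕p849897∕E5 (`twisted_recip_of_forward_recip`, `lift_comp_gal`, `S.recip`, …)
import Literature.AlgebraicGeometry.ShimuraVarieties.UnitaryCurveHeckeOrbitExtContinuous      -- ★ p850424 (LA4-p02): (β1) `RecordSystemGS.map_eq_of_heckeOrbit_of_continuous_mk_comp` (morphism vs piecewise-continuous map)
import Literature.AlgebraicGeometry.Motives.GaloisThickeningLiftAlongFieldHom                  -- ★ p849545 (LA4-p01): `thickeningLift_left_eq_comp_of_left_eq` (sheet points along a field hom)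
import HarnessLib

/-!
# THE GLOBAL POINT LAW ON THE TWISTED SHEET: the classifying point of the slice at `ℓ_{τE∘γ} z` is `f₂ [v, aK]`, for a point map `f₂` that is merely CONTINUOUS
# ([Milne 2005] Lemma 13.5 + Thm. 13.6 p. 118 with the second slice replaced by a continuous map; [Shimura 1998] §18.6; [RSZ 2020] §3.2: the sheets of `M ⊗_F Fᵢ`)

Topic `AlgebraicGeometry/ShimuraVarieties`; namespace `…ShimuraVarieties.UnitaryCanonicalModel` (the objects of ★ `UnitaryShimuraCurveRecord` ∕ ★ E5
`UnitaryCurveSiegelDescent`).  THEOREMS ONLY (no definition, no instance, no notation, no named fact, no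
`sorry`).  Cell `hodgecm-mathlib` (D-0151), P6 «MOD programme», crux hLiu418 (stmt-HodgeConjecture-24832, `--supports`, count-neutral), line «L4», closer
`stub_SHEET` ROAD B′∕(β) (LA4-plan (g2) 2026-09-02 07:43:53Z ∕ 08:01:03Z, A-p01 (g28) 08:01:35Z): **DEAL #37 «`f₂` + THE GLOBAL POINT LAW ON THE TWISTED SHEET»**
(LA4-p01 (g3)).  In road B′ the Serre tensor is taken PER COMPLEX FIBRE, so there is no second slice MORPHISM `ε₂`∕`ψ₂` (★ p849947∕p850264 compare two morphisms);
the twisted side is only a continuous POINT MAP `f₂ : Sh_K(ℂ) → M(ℂ)` with Siegel shadow `[J v, b(a)·ũ_V(1, t)]` (continuity ★ p850443 `UnitaryCurveSiegelShadowContinuous`,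
DEAL #35).  This file proves that the classifying point of the chart slice `ε` at the `γ`-TWISTED sheet point `ℓ_{τE∘γ} z` over EVERY complex point `z` equals
`f₂ (pts z)` — the «classified by THAT point» input of DEAL #34 (ADM ⇒ ISO) in LA7-p01 (g3)՚s socket `OrganSHEETComplex`.

THE MATHEMATICS.  Let `ψ : (M_K)_ℂ → M_ℂ` be the complexification of the `E`-slice `ε` (it reads the chart map `f`, ★ p850264 §1), `σL ∈ Aut(ℂ∕τL)` a lift of
`γ ∈ Aut_L(E)` (`σL ∘ τE = τE ∘ γ`), `s ↔ σL` an Artin correspondent with twist `d` at a special `x₀ = [τw]`, and assume the FORWARD law `σL|_ℚ • f[x₀, a] = f₂[x₀, d·a]`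
(★ p849999).  KEY OBSERVATION: at every complex `z` BOTH «the classifying point of `ε` at `ℓ_{τE∘γ} z`» AND «the point of the `σL`-CONJUGATE slice
`T′ := (1 × Spec σL) ≫ ψ ≫ (1 × Spec σL|_ℚ⁻¹)` at `z`» equal `σL|_ℚ • f (pts (σL⁻¹ • z))` — the first since `ℓ_{τE∘γ}(z) = Spec σL ≫ ℓ_{τE}(σL⁻¹ • z)` (★ p849545) and
`ε` reads `f` on the `τE`-sheet (§4), the second by ★ E5՚s Galois bookkeeping (§2).  `T′` is a MORPHISM over `ℂ`, hence its point map is continuous; `f₂` is continuous;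
on the Hecke orbit `{[x₀, b]}` both equal `f₂[x₀, b]` (reciprocity at `σL⁻¹` + the twisted law from the forward one, ★ p849947 §1); Hecke-orbit density ([Milne 2005]
Lemma 13.5, ★ p850424) gives §3, and §4 + §3 the head §5.  The point map `f₂` itself (twisted class `[J v, b(a)·u]`) is ★ `UnitaryCurveSiegelPointMapTwisted`.

* §2 `RecordSystemGS.map_conj_eq_bce_smul` — the conjugate slice՚s point at ANY `P`: `T′ (P,1) = (σL|_ℚ • f (pts (σL⁻¹ • P)), 1)`;
* §3 **`RecordSystemGS.smul_map_pts_eq_fTwo_of_forward_recip`** (THEOREM A, given a complex slice `ψ` reading `f`) and **`…_of_slice`** (given the `E`-slice `ε`,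
  E5 currency): `σL|_ℚ • f (pts (σL⁻¹ • P)) = f₂ (pts P)` for EVERY `P`;
* §4 **`RecordSystemGS.thickeningLift_comp_slice_fst_eq_smul`** (THEOREM B, sheet bookkeeping, no density): `ℓ_{eT∘γ}(z) ≫ ε ≫ pr₁ = (σL|_ℚ • f (pts (σL⁻¹ • z))).left`;
* §5 **HEAD `RecordSystemGS.thickeningLift_comp_slice_fst_eq_fTwo`**: `ℓ_{eT∘γ}(z) ≫ ε ≫ pr₁ = (f₂ (pts z)).left` for every complex `z`.
HONEST LABEL: HC_CM is proved only modulo the 2 remaining named inputs (hLiu418 24832, h413 24833) until rung 0 closes; this file is generic and count-neutral.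

## References
* [Milne2005ShimuraVarieties] J. S. Milne, *Introduction to Shimura varieties* (2005; rev. 2017), Prop. 13.1 p. 117, Lemma 13.5 and Thm. 13.6 (proof) p. 118; Def. 12.8 (62) p. 114.
* [Shimura1998] G. Shimura, *Abelian Varieties with Complex Multiplication and Modular Functions* (1998), §18.6 (pp. 124–128).
* [RapoportSmithlingZhang2020Diagonal] M. Rapoport, B. Smithling, W. Zhang (2020), §3.2 p. 11, §4.3 p. 20.  [GortzWedhorn2020] *Algebraic Geometry I*, §(4.7)–(4.9), Prop. 4.16, §(14.20).
-/

set_option autoImplicit false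

noncomputable section

open Function MulAction Topology NumberField IsDedekindDomain CategoryTheory CategoryTheory.Limits Matrix
  AlgebraicGeometry Cardinal
open scoped Matrix ComplexOrder
open Literature.AlgebraicGeometry.Motives Literature.NumberTheory.Automorphic Literature.NumberTheory.Automorphic.UnitaryGroup
open Literature.NumberTheory.Automorphic.Liu2021.AppendixC (C5.OpenCompactSubgroup C5.SmallLevel)
open Literature.AlgebraicGeometry.Motives.AbelianVariety (bcSpec bcFunctor specAut)

namespace Literature.AlgebraicGeometry.ShimuraVarieties


/-! ### §2 The conjugate slice՚s point at ANY complex point -/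

namespace UnitaryCanonicalModel

variable {L : Type} [Field L] [NumberField L] [IsCMField L] {Jstar : Matrix (Fin 2) (Fin 2) L} {τ : L →+* ℂ}
  {K₀ : C5.OpenCompactSubgroup ↥(finAdelic (↥(maximalRealSubfield L)) L (IsCMField.complexConj L) 2 Jstar)}

omit [IsCMField L] in
/-- `specAut` only sees the underlying ring map: an automorphism over `τL` and its restriction of scalars to `ℚ` have the same `Spec` (★ p849897, private there). [folklore] -/
private theorem specAut_restrictScalars_rat' (σL : letI : Algebra L ℂ := τ.toAlgebra; ℂ ≃ₐ[L] ℂ) :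
    letI : Algebra L ℂ := τ.toAlgebra
    specAut ℂ σL = specAut ℂ (σL.restrictScalars ℚ) := by
  letI : Algebra L ℂ := τ.toAlgebra
  have hh : (σL : ℂ →+* ℂ) = ((σL.restrictScalars ℚ : ℂ ≃ₐ[ℚ] ℂ) : ℂ →+* ℂ) := RingHom.ext fun _ => rfl
  change Spec.map (CommRingCat.ofHom (σL : ℂ →+* ℂ)) = Spec.map (CommRingCat.ofHom ((σL.restrictScalars ℚ : ℂ ≃ₐ[ℚ] ℂ) : ℂ →+* ℂ))
  rw [hh]

section Conj

variable (S : RecordSystemGS L Jstar τ K₀) (K : C5.SmallLevel K₀) (M : SchemeOver ℚ)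
  (f : ShimuraSetGS L Jstar τ K.1.1 → ComplexPoints M)
  (ψ : (Motives.baseChangeHom τ).obj (S.M.obj K) ⟶ (Motives.baseChange ℚ ℂ).obj M)
  (hψ : letI : Algebra L ℂ := τ.toAlgebra
    ∀ P : ComplexPoints (S.M.obj K),
      (AlgPoints.map ψ (AlgPoints.baseChangeEquiv τ (S.M.obj K) P)).left ≫ Motives.baseChangeHomFst (algebraMap ℚ ℂ) M =
        (f (S.pts K P)).left)
  (t : letI : Algebra L ℂ := τ.toAlgebra; GaloisDescent.bc ℂ (S.M.obj K) ⟶ GaloisDescent.bc ℂ M) (ht : t = ψ.left)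

set_option maxHeartbeats 800000 in -- large adelic ∕ Shimura-set terms: instance-heavy statements (as ★ p849897 §1)
include hψ ht in
/-- **THE CONJUGATE SLICE՚S POINT AT ANY COMPLEX POINT**: for `σL ∈ Aut(ℂ∕τL)`, ANY morphism `T′` over `ℂ` with underlying morphism `gal σL⁻¹ ≫ t ≫ gal σL|_ℚ`
(`t = ψ.left`) and EVERY complex point `P`: `T′ (P, 1) = (σL|_ℚ • f (pts (σL⁻¹ • P)), 1)` (★ p849897 §1՚s computation, with no reciprocity and no second slice).
[cite: Milne2005ShimuraVarieties, §13 Prop. 13.1 p. 117 and Thm. 13.6 p. 118 L29–39] -/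
theorem RecordSystemGS.map_conj_eq_bce_smul (σL : letI : Algebra L ℂ := τ.toAlgebra; ℂ ≃ₐ[L] ℂ)
    (T' : (Motives.baseChangeHom τ).obj (S.M.obj K) ⟶ (Motives.baseChange ℚ ℂ).obj M)
    (hT' : letI : Algebra L ℂ := τ.toAlgebra
      GaloisDescent.gal ℂ (S.M.obj K) σL⁻¹ ≫ t ≫ GaloisDescent.gal ℂ M (σL.restrictScalars ℚ) = T'.left)
    (P : letI : Algebra L ℂ := τ.toAlgebra; ComplexPoints (S.M.obj K)) :
    letI : Algebra L ℂ := τ.toAlgebra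
    AlgPoints.map T' (AlgPoints.baseChangeEquiv τ (S.M.obj K) P) =
      AlgPoints.baseChangeEquiv (algebraMap ℚ ℂ) M ((σL.restrictScalars ℚ) • f (S.pts K (σL⁻¹ • P))) := by
  letI iL : Algebra L ℂ := τ.toAlgebra
  have hspec : specAut ℂ σL = specAut ℂ (σL.restrictScalars ℚ) := specAut_restrictScalars_rat' σL
  -- `ψ` reads `f` on the points `(Q, 1)`
  have FT : ∀ Q : ComplexPoints (S.M.obj K),
      pullback.lift Q.toSpecHom (𝟙 (Spec (.of ℂ))) (toSpecHom_comp_hom_eq (τ := τ) (S.M.obj K) Q) ≫ t =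
        pullback.lift (f (S.pts K Q)).toSpecHom (𝟙 (Spec (.of ℂ))) (toSpecHom_comp_hom_eq (τ := algebraMap ℚ ℂ) M _) :=
    fun Q => S.lift_comp_sliceComplex_left K M f ψ hψ t ht Q
  apply Over.OverMorphism.ext
  change (AlgPoints.baseChangeEquiv τ (S.M.obj K) P).left ≫ T'.left =
    (AlgPoints.baseChangeEquiv (algebraMap ℚ ℂ) M ((σL.restrictScalars ℚ) • f (S.pts K (σL⁻¹ • P)))).left
  rw [← lift_eq_baseChangeEquiv_left, ← hT', ← lift_eq_baseChangeEquiv_left (τ := algebraMap ℚ ℂ)]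
  change pullback.lift P.toSpecHom (𝟙 (Spec (.of ℂ))) (toSpecHom_comp_hom_eq (τ := τ) (S.M.obj K) P) ≫
      (GaloisDescent.gal ℂ (S.M.obj K) σL⁻¹ ≫ t ≫ GaloisDescent.gal ℂ M (σL.restrictScalars ℚ)) =
    pullback.lift ((σL.restrictScalars ℚ) • f (S.pts K (σL⁻¹ • P))).toSpecHom (𝟙 (Spec (.of ℂ)))
      (toSpecHom_comp_hom_eq (τ := algebraMap ℚ ℂ) M _)
  have step1 : pullback.lift P.toSpecHom (𝟙 (Spec (.of ℂ))) (toSpecHom_comp_hom_eq (τ := τ) (S.M.obj K) P) ≫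
      GaloisDescent.gal ℂ (S.M.obj K) σL⁻¹ =
      specAut ℂ σL ≫ pullback.lift (σL⁻¹ • P).toSpecHom (𝟙 (Spec (.of ℂ)))
        (toSpecHom_comp_hom_eq (τ := τ) (S.M.obj K) (σL⁻¹ • P)) := by
    have h := lift_comp_gal (τ := τ) (S.M.obj K) σL⁻¹ P
    rwa [inv_inv] at h
  have step3 : ∀ Q : ComplexPoints M,
      pullback.lift Q.toSpecHom (𝟙 (Spec (.of ℂ))) (toSpecHom_comp_hom_eq (τ := algebraMap ℚ ℂ) M Q) ≫
          GaloisDescent.gal ℂ M (σL.restrictScalars ℚ) =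
        specAut ℂ (σL.restrictScalars ℚ)⁻¹ ≫ pullback.lift ((σL.restrictScalars ℚ) • Q).toSpecHom (𝟙 (Spec (.of ℂ)))
          (toSpecHom_comp_hom_eq (τ := algebraMap ℚ ℂ) M ((σL.restrictScalars ℚ) • Q)) :=
    fun Q => lift_comp_gal (τ := algebraMap ℚ ℂ) M (σL.restrictScalars ℚ) Q
  rw [← Category.assoc, step1, Category.assoc, ← Category.assoc (pullback.lift _ _ _), FT (σL⁻¹ • P), step3, ← Category.assoc, hspec,
    AbelianVariety.specAut_comp_specAut_symm, Category.id_comp]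

end Conj

/-! ### §3 THEOREM A — the conjugate reading `σL|_ℚ • f (pts (σL⁻¹ • P))` equals `f₂ (pts P)` EVERYWHERE, from the forward law at ONE special point and continuity -/

section PointLaw

variable (S : RecordSystemGS L Jstar τ K₀) (K : C5.SmallLevel K₀) (M : SchemeOver ℚ)
  (f : ShimuraSetGS L Jstar τ K.1.1 → ComplexPoints M)

set_option maxHeartbeats 800000 in -- large adelic ∕ Shimura-set terms: instance-heavy statements (as ★ p849947 §2)
/-- **THEOREM A (given a complex slice `ψ` reading `f`).**  `M` separated, `J⋆` `c`-hermitian with unit determinant; `ψ : (M_K)_ℂ → M_ℂ` reads `f`; `σL ∈ Aut(ℂ∕τL)`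
with Artin correspondent `s`, twist `d` at the special `x₀ = [τw]`; `f₂ : Sh_K(ℂ) → M(ℂ)` ANY map continuous in the cone variable on every piece with the FORWARD law
`σL|_ℚ • f[x₀, a] = f₂[x₀, d·a]`.  THEN `σL|_ℚ • f (pts (σL⁻¹ • P)) = f₂ (pts P)` for EVERY complex point `P`: the left side is the point map of the morphism
`T′ := gal σL⁻¹ ≫ ψ ≫ gal σL|_ℚ` over `ℂ` (§2, ★ `GaloisDescent.gal_snd`), it agrees with `f₂` on the Hecke orbit of `x₀` (`S.recip` at `σL⁻¹`, ★
`twisted_recip_of_forward_recip`), hence everywhere (★ p850424 with the continuous reading `π := bce⁻¹`, `M(ℂ)` Hausdorff).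
[cite: Milne2005ShimuraVarieties, Lemma 13.5 and Thm. 13.6 (proof) p. 118; Def. 12.8 (62) p. 114] [cite: Shimura1998, §18.6 (pp. 124–128)] -/
theorem RecordSystemGS.smul_map_pts_eq_fTwo_of_forward_recip [IsSeparated M.hom]
    (hJ : (Jstar.map (IsCMField.complexConj L))ᵀ = Jstar) (hdet : IsUnit Jstar.det)
    (ψ : (Motives.baseChangeHom τ).obj (S.M.obj K) ⟶ (Motives.baseChange ℚ ℂ).obj M)
    (hψ : letI : Algebra L ℂ := τ.toAlgebra
      ∀ P : ComplexPoints (S.M.obj K),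
        (AlgPoints.map ψ (AlgPoints.baseChangeEquiv τ (S.M.obj K) P)).left ≫ Motives.baseChangeHomFst (algebraMap ℚ ℂ) M =
          (f (S.pts K P)).left)
    (σL : letI : Algebra L ℂ := τ.toAlgebra; ℂ ≃ₐ[L] ℂ)
    {w : Fin 2 → L} (hw : (fun i => τ (w i)) ∈ negCone (Jstar.map τ)) {s : (FiniteAdeleRing (𝓞 L) L)ˣ}
    (hs : letI : Algebra L ℂ := τ.toAlgebra; IsArtinCorrespondent L τ s σL.toRingEquiv)
    {d : ↥(finAdelic (↥(maximalRealSubfield L)) L (IsCMField.complexConj L) 2 Jstar)}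
    (hd : IsDiagTwistGS L Jstar w (recipFactor L s) d)
    (f₂ : ShimuraSetGS L Jstar τ K.1.1 → ComplexPoints M)
    (hf₂ : ∀ a : ↥(finAdelic (↥(maximalRealSubfield L)) L (IsCMField.complexConj L) 2 Jstar),
      Continuous fun x : ↥(negCone (Jstar.map τ)) => f₂ (ShimuraSetGS.mk L Jstar τ K.1.1 (x : Fin 2 → ℂ) x.2 a))
    (hfw : letI : Algebra L ℂ := τ.toAlgebra
      ∀ a : ↥(finAdelic (↥(maximalRealSubfield L)) L (IsCMField.complexConj L) 2 Jstar),
        (σL.restrictScalars ℚ) • f (ShimuraSetGS.mk L Jstar τ K.1.1 (fun i => τ (w i)) hw a) =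
          f₂ (ShimuraSetGS.mk L Jstar τ K.1.1 (fun i => τ (w i)) hw (d * a))) :
    letI : Algebra L ℂ := τ.toAlgebra
    ∀ P : ComplexPoints (S.M.obj K), (σL.restrictScalars ℚ) • f (S.pts K (σL⁻¹ • P)) = f₂ (S.pts K P) := by
  letI iL : Algebra L ℂ := τ.toAlgebra
  haveI : T2Space (ComplexPoints M) := ComplexPoints.t2Space_of_isSeparated M
  have hspec : specAut ℂ σL = specAut ℂ (σL.restrictScalars ℚ) := specAut_restrictScalars_rat' σL
  -- `t := ψ.left` read on the fibre products, and the conjugate `T′ := gal σL⁻¹ ≫ t ≫ gal σL|_ℚ` as a morphism OVER `ℂ`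
  obtain ⟨t, ht⟩ : ∃ t : GaloisDescent.bc ℂ (S.M.obj K) ⟶ GaloisDescent.bc ℂ M, t = ψ.left := ⟨_, rfl⟩
  have hTsnd : t ≫ pullback.snd M.hom (bcSpec ℚ ℂ) = pullback.snd (S.M.obj K).hom (bcSpec L ℂ) := by rw [ht]; exact Over.w ψ
  have hw' : (GaloisDescent.gal ℂ (S.M.obj K) σL⁻¹ ≫ t ≫ GaloisDescent.gal ℂ M (σL.restrictScalars ℚ)) ≫
      pullback.snd M.hom (bcSpec ℚ ℂ) = pullback.snd (S.M.obj K).hom (bcSpec L ℂ) := by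
    rw [Category.assoc, Category.assoc, GaloisDescent.gal_snd, ← Category.assoc t, hTsnd,
      GaloisDescent.gal_snd_assoc, inv_inv, hspec, AbelianVariety.specAut_comp_specAut_symm, Category.comp_id]
  let T' : (Motives.baseChangeHom τ).obj (S.M.obj K) ⟶ (Motives.baseChange ℚ ℂ).obj M :=
    Over.homMk (GaloisDescent.gal ℂ (S.M.obj K) σL⁻¹ ≫ t ≫ GaloisDescent.gal ℂ M (σL.restrictScalars ℚ)) hw'
  have hT'pt : ∀ P : ComplexPoints (S.M.obj K), AlgPoints.map T' (AlgPoints.baseChangeEquiv τ (S.M.obj K) P) =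
      AlgPoints.baseChangeEquiv (algebraMap ℚ ℂ) M ((σL.restrictScalars ℚ) • f (S.pts K (σL⁻¹ • P))) :=
    fun P => S.map_conj_eq_bce_smul K M f ψ hψ t ht σL T' rfl P
  -- the twisted law at an Artin correspondent `s′` of `σL⁻¹` with its twist `d′`
  obtain ⟨s', hs'⟩ := exists_finiteIdele_isArtinCorrespondent_algEquiv L τ σL⁻¹
  obtain ⟨d', hd'⟩ := exists_isDiagTwistGS_recipFactor' L Jstar hJ (hermForm_self_ne_zero_of_embedding_mem_negCone hw) s'
  have htw := S.twisted_recip_of_forward_recip K M f f₂ σL hw hs hs' hd hd' hfw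
  -- the junction `e` of ★ E5 and the (opaque) reading `π := bce⁻¹ : M_ℂ(ℂ) → M(ℂ)`
  obtain ⟨e, he⟩ := S.exists_homeomorph_complexFibre K
  obtain ⟨π, hπdef⟩ : ∃ π : ComplexPoints ((Motives.baseChange ℚ ℂ).obj M) → ComplexPoints M,
      π = fun Q => (AlgPoints.baseChangeEquiv (algebraMap ℚ ℂ) M).symm Q := ⟨_, rfl⟩
  have hπ : Continuous π := by
    rw [hπdef]
    exact Motives.AlgPoints.continuous_baseChangeEquiv_symm (algebraMap ℚ ℂ) M
  have hπbce : ∀ Q : ComplexPoints M, π (AlgPoints.baseChangeEquiv (algebraMap ℚ ℂ) M Q) = Q := fun Q => by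
    rw [hπdef]
    exact (AlgPoints.baseChangeEquiv (algebraMap ℚ ℂ) M).symm_apply_apply Q
  -- the conjugate slice read through `π` at the point `pts⁻¹ p`
  have hTπ : ∀ (v : Fin 2 → ℂ) (hv : v ∈ negCone (Jstar.map τ)) (b : ↥(finAdelic (↥(maximalRealSubfield L)) L (IsCMField.complexConj L) 2 Jstar)),
      π (AlgPoints.map T' (e.symm (ShimuraSetGS.mk L Jstar τ K.1.1 v hv b))) =
        (σL.restrictScalars ℚ) • f (S.pts K (σL⁻¹ • (S.pts K).symm (ShimuraSetGS.mk L Jstar τ K.1.1 v hv b))) := by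
    intro v hv b
    rw [he]
    exact (congrArg π (hT'pt _)).trans (hπbce _)
  -- agreement on the Hecke orbit of `x₀ = [τw]`: reciprocity at `σL⁻¹`, then the twisted law
  have horb : ∀ b : ↥(finAdelic (↥(maximalRealSubfield L)) L (IsCMField.complexConj L) 2 Jstar),
      π (AlgPoints.map T' (e.symm (ShimuraSetGS.mk L Jstar τ K.1.1 (fun i => τ (w i)) hw b))) =
        f₂ (ShimuraSetGS.mk L Jstar τ K.1.1 (fun i => τ (w i)) hw b) := by
    intro b
    rw [hTπ, S.recip K σL⁻¹ s' hs' w hw d' hd' b, Homeomorph.apply_symm_apply]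
    exact htw b
  -- density: the two maps agree everywhere
  have hall := S.map_eq_of_heckeOrbit_of_continuous_mk_comp K hJ hdet e T' π hπ f₂ hf₂ hw horb
  intro P
  obtain ⟨v, hv, b, hP⟩ := ShimuraSetGS.mk_surjective L Jstar τ K.1.1 (S.pts K P)
  have hPe : P = (S.pts K).symm (ShimuraSetGS.mk L Jstar τ K.1.1 v hv b) := by
    rw [hP, Homeomorph.symm_apply_apply]
  have h1 := hall (ShimuraSetGS.mk L Jstar τ K.1.1 v hv b)
  rw [hTπ, ← hPe, hP] at h1
  exact h1

set_option maxHeartbeats 800000 in -- large adelic ∕ Shimura-set terms: instance-heavy statements (as ★ p850264 §2)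
/-- **THEOREM A FROM THE `E`-SLICE `ε` (E5 currency)**: as `smul_map_pts_eq_fTwo_of_forward_recip`, the complex slice `ψ` being the complexification of an `E`-slice
`ε : M_K ⊗_L E → M ⊗_ℚ E` that reads `f` on the `τE`-sheet (★ p850264 bookkeeping: ★ `Motives.exists_iso_baseChangeHom_baseChange`, ★ `lift_comp_sliceComplexOfSlice_fst`).
[cite: Milne2005ShimuraVarieties, Lemma 13.5 and Thm. 13.6 (proof) p. 118; Prop. 13.1 p. 117] [cite: GortzWedhorn2020, Prop. 4.16 and §(4.7)] -/
theorem RecordSystemGS.smul_map_pts_eq_fTwo_of_forward_recip_of_slice [IsSeparated M.hom]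
    (hJ : (Jstar.map (IsCMField.complexConj L))ᵀ = Jstar) (hdet : IsUnit Jstar.det)
    {E : Type} [Field E] [NumberField E] [Algebra L E] (τE : E →+* ℂ) (hτ : τE.comp (algebraMap L E) = τ)
    (ε : (Motives.baseChange L E).obj (S.M.obj K) ⟶ (Motives.baseChange ℚ E).obj M)
    (hε : letI : Algebra E ℂ := τE.toAlgebra
      ∀ (P : ComplexPoints ((Motives.baseChange L E).obj (S.M.obj K)))
        (Pflat : letI : Algebra L ℂ := τ.toAlgebra; ComplexPoints (S.M.obj K)),
        Pflat.left = P.left ≫ pullback.fst (S.M.obj K).hom (bcSpec L E) →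
        (AlgPoints.map ε P).left ≫ pullback.fst M.hom (bcSpec ℚ E) =
          (letI : Algebra L ℂ := τ.toAlgebra; (f (S.pts K Pflat)).left))
    (σL : letI : Algebra L ℂ := τ.toAlgebra; ℂ ≃ₐ[L] ℂ)
    {w : Fin 2 → L} (hw : (fun i => τ (w i)) ∈ negCone (Jstar.map τ)) {s : (FiniteAdeleRing (𝓞 L) L)ˣ}
    (hs : letI : Algebra L ℂ := τ.toAlgebra; IsArtinCorrespondent L τ s σL.toRingEquiv)
    {d : ↥(finAdelic (↥(maximalRealSubfield L)) L (IsCMField.complexConj L) 2 Jstar)}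
    (hd : IsDiagTwistGS L Jstar w (recipFactor L s) d)
    (f₂ : ShimuraSetGS L Jstar τ K.1.1 → ComplexPoints M)
    (hf₂ : ∀ a : ↥(finAdelic (↥(maximalRealSubfield L)) L (IsCMField.complexConj L) 2 Jstar),
      Continuous fun x : ↥(negCone (Jstar.map τ)) => f₂ (ShimuraSetGS.mk L Jstar τ K.1.1 (x : Fin 2 → ℂ) x.2 a))
    (hfw : letI : Algebra L ℂ := τ.toAlgebra
      ∀ a : ↥(finAdelic (↥(maximalRealSubfield L)) L (IsCMField.complexConj L) 2 Jstar),
        (σL.restrictScalars ℚ) • f (ShimuraSetGS.mk L Jstar τ K.1.1 (fun i => τ (w i)) hw a) =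
          f₂ (ShimuraSetGS.mk L Jstar τ K.1.1 (fun i => τ (w i)) hw (d * a))) :
    letI : Algebra L ℂ := τ.toAlgebra
    ∀ P : ComplexPoints (S.M.obj K), (σL.restrictScalars ℚ) • f (S.pts K (σL⁻¹ • P)) = f₂ (S.pts K P) := by
  letI iE : Algebra E ℂ := τE.toAlgebra; letI iL : Algebra L ℂ := τ.toAlgebra
  -- the transitivity isomorphisms `gX : (M_K ⊗_L E)_ℂ ≅ (M_K)_ℂ`, `gM : (M ⊗_ℚ E)_ℂ ≅ M_ℂ`, read on underlying morphisms (★ p850264 bookkeeping)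
  obtain ⟨gX, hgX1, hgX2, -⟩ := Motives.exists_iso_baseChangeHom_baseChange hτ (S.M.obj K)
  have hτℚ : τE.comp (algebraMap ℚ E) = algebraMap ℚ ℂ := Subsingleton.elim _ _
  obtain ⟨gM, hgM1, -, -⟩ := Motives.exists_iso_baseChangeHom_baseChange (τ := algebraMap ℚ ℂ) hτℚ M
  obtain ⟨tX, htX⟩ : ∃ tX : GaloisDescent.bc ℂ ((Motives.baseChange L E).obj (S.M.obj K)) ⟶ GaloisDescent.bc ℂ (S.M.obj K),
      tX = gX.hom.left := ⟨_, rfl⟩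
  obtain ⟨u, hu⟩ : ∃ u : GaloisDescent.bc ℂ (S.M.obj K) ⟶ GaloisDescent.bc ℂ ((Motives.baseChange L E).obj (S.M.obj K)),
      u = gX.inv.left := ⟨_, rfl⟩
  obtain ⟨tM, htM⟩ : ∃ tM : GaloisDescent.bc ℂ ((Motives.baseChange ℚ E).obj M) ⟶ GaloisDescent.bc ℂ M, tM = gM.hom.left := ⟨_, rfl⟩
  obtain ⟨tε, htε⟩ : ∃ tε : GaloisDescent.bc ℂ ((Motives.baseChange L E).obj (S.M.obj K)) ⟶ GaloisDescent.bc ℂ ((Motives.baseChange ℚ E).obj M),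
      tε = ((bcFunctor E ℂ).map ε).left := ⟨_, rfl⟩
  have huX : u ≫ tX = 𝟙 _ := by rw [htX, hu]; exact congrArg CommaMorphism.left gX.inv_hom_id
  have hgX1' : tX ≫ pullback.fst (S.M.obj K).hom (bcSpec L ℂ) =
      pullback.fst ((Motives.baseChange L E).obj (S.M.obj K)).hom (bcSpec E ℂ) ≫ pullback.fst (S.M.obj K).hom (bcSpec L E) := by
    rw [htX]; exact hgX1
  have hgX2' : tX ≫ pullback.snd (S.M.obj K).hom (bcSpec L ℂ) = pullback.snd ((Motives.baseChange L E).obj (S.M.obj K)).hom (bcSpec E ℂ) := by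
    rw [htX]; exact hgX2
  have hgM1' : tM ≫ pullback.fst M.hom (bcSpec ℚ ℂ) =
      pullback.fst ((Motives.baseChange ℚ E).obj M).hom (bcSpec E ℂ) ≫ pullback.fst M.hom (bcSpec ℚ E) := by
    rw [htM]; exact hgM1
  have hu1 : u ≫ pullback.fst ((Motives.baseChange L E).obj (S.M.obj K)).hom (bcSpec E ℂ) ≫ pullback.fst (S.M.obj K).hom (bcSpec L E) =
      pullback.fst (S.M.obj K).hom (bcSpec L ℂ) := by
    rw [← hgX1', ← Category.assoc, huX, Category.id_comp]
  have hu2 : u ≫ pullback.snd ((Motives.baseChange L E).obj (S.M.obj K)).hom (bcSpec E ℂ) = pullback.snd (S.M.obj K).hom (bcSpec L ℂ) := by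
    rw [← hgX2', ← Category.assoc, huX, Category.id_comp]
  -- the complex slice `ψ := gX⁻¹ ≫ ε_ℂ ≫ gM` and its reading
  let ψ : (Motives.baseChangeHom τ).obj (S.M.obj K) ⟶ (Motives.baseChange ℚ ℂ).obj M := gX.inv ≫ (bcFunctor E ℂ).map ε ≫ gM.hom
  obtain ⟨t, ht⟩ : ∃ t : GaloisDescent.bc ℂ (S.M.obj K) ⟶ GaloisDescent.bc ℂ M, t = ψ.left := ⟨_, rfl⟩
  have htdef : t = u ≫ tε ≫ tM := by rw [ht, hu, htε, htM]; rfl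
  have hψ : ∀ P : ComplexPoints (S.M.obj K),
      (AlgPoints.map ψ (AlgPoints.baseChangeEquiv τ (S.M.obj K) P)).left ≫ Motives.baseChangeHomFst (algebraMap ℚ ℂ) M =
        (f (S.pts K P)).left := by
    intro P
    have h1 := S.lift_comp_sliceComplexOfSlice_fst K M τE f ε hε tε htε u hu1 hu2 tM hgM1' P
    rw [AlgPoints.map_apply, Over.comp_left, ← lift_eq_baseChangeEquiv_left, ← ht, htdef]
    erw [Category.assoc]
    exact h1
  exact S.smul_map_pts_eq_fTwo_of_forward_recip K M f hJ hdet ψ hψ σL hw hs hd f₂ hf₂ hfw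

end PointLaw

/-! ### §4 THEOREM B — the slice read at the TWISTED sheet point `ℓ_{eT∘γ}(z)` is `σL|_ℚ • f (pts (σL⁻¹ • z))` (sheet bookkeeping, no density) -/

section Sheet

variable (S : RecordSystemGS L Jstar τ K₀) (K : C5.SmallLevel K₀) (M : SchemeOver ℚ)
  (f : ShimuraSetGS L Jstar τ K.1.1 → ComplexPoints M)
  {E : Type} [Field E] [NumberField E] [Algebra L E] (τE : E →+* ℂ)
  (ε : (Motives.baseChange L E).obj (S.M.obj K) ⟶ (Motives.baseChange ℚ E).obj M)
  (hε : letI : Algebra E ℂ := τE.toAlgebra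
    ∀ (P : ComplexPoints ((Motives.baseChange L E).obj (S.M.obj K)))
      (Pflat : letI : Algebra L ℂ := τ.toAlgebra; ComplexPoints (S.M.obj K)),
      Pflat.left = P.left ≫ pullback.fst (S.M.obj K).hom (bcSpec L E) →
      (AlgPoints.map ε P).left ≫ pullback.fst M.hom (bcSpec ℚ E) =
        (letI : Algebra L ℂ := τ.toAlgebra; (f (S.pts K Pflat)).left))
  (eT : letI : Algebra L ℂ := τ.toAlgebra; E →ₐ[L] ℂ) (heT : ∀ x : E, eT x = τE x)
  (σL : letI : Algebra L ℂ := τ.toAlgebra; ℂ ≃ₐ[L] ℂ) (γ : E →ₐ[L] E) (hσγ : ∀ x : E, σL (τE x) = τE (γ x))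

set_option maxHeartbeats 800000 in -- large adelic ∕ Shimura-set terms: instance-heavy statements
include hε heT hσγ in
/-- **THEOREM B — THE SLICE READ AT THE TWISTED SHEET POINT.**  For the chart sheet `eT : E →ₐ[L] ℂ` (= `τE`), a lift `σL ∈ Aut(ℂ∕τL)` of `γ ∈ Aut_L(E)` and every
complex point `z`: `ℓ_{eT∘γ}(z) ≫ ε ≫ pr₁ = (σL|_ℚ • f (pts (σL⁻¹ • z))).left` — `ℓ_{eT∘γ}(z) = Spec σL ≫ ℓ_{eT}(σL⁻¹ • z)` (★ `thickeningLift_left_eq_comp_of_left_eq`, LEFT action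
`(σ • z) = Spec σ ≫ z`) and `ε` reads `f` on the `τE`-sheet point over `σL⁻¹ • z` (`hε`).  No reciprocity, no density.
[cite: RapoportSmithlingZhang2020Diagonal, §3.2 p. 11 (the sheets of `M ⊗_F Fᵢ`)] [cite: GortzWedhorn2020, §(4.8)–(4.9) and §(14.20)] [cite: Milne2005ShimuraVarieties, Prop. 13.1 p. 117] -/
theorem RecordSystemGS.thickeningLift_comp_slice_fst_eq_smul (z : letI : Algebra L ℂ := τ.toAlgebra; ComplexPoints (S.M.obj K)) :
    letI : Algebra L ℂ := τ.toAlgebra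
    (thickeningLift (eT.comp γ) (S.M.obj K) z).left ≫ ε.left ≫ pullback.fst M.hom (bcSpec ℚ E) =
      ((σL.restrictScalars ℚ) • f (S.pts K (σL⁻¹ • z))).left := by
  letI iE : Algebra E ℂ := τE.toAlgebra; letI iL : Algebra L ℂ := τ.toAlgebra
  -- the sheets: `σL ∘ eT = eT ∘ γ`
  have hcomp : σL.toAlgHom.comp eT = eT.comp γ := AlgHom.ext fun x => by
    change σL (eT x) = eT (γ x)
    rw [heT, heT]
    exact hσγ x
  -- `z = Spec σL ≫ (σL⁻¹ • z)`
  have hyz : z.left = Spec.map (CommRingCat.ofHom σL.toAlgHom.toRingHom) ≫ (σL⁻¹ • z).left := by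
    rw [AlgPoints.smul_left, ← Category.assoc, ← Spec.map_comp, ← CommRingCat.ofHom_comp]
    have hid : (σL.toAlgHom.toRingHom).comp ((σL⁻¹ : ℂ ≃ₐ[L] ℂ) : ℂ →+* ℂ) = RingHom.id ℂ := RingHom.ext fun x => σL.apply_symm_apply x
    rw [hid, CommRingCat.ofHom_id]
    erw [Spec.map_id, Category.id_comp]
  -- functoriality of sheet points along `σL`
  have key := Motives.thickeningLift_left_eq_comp_of_left_eq eT σL.toAlgHom (S.M.obj K) (σL⁻¹ • z) z hyz
  rw [hcomp] at key; rw [key]; erw [Category.assoc]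
  -- the `τE`-sheet point over `y := σL⁻¹ • z` as an `E`-point of `M_K ⊗_L E`, and `ε` reads `f` there
  have hw₀ : (thickeningLift eT (S.M.obj K) (σL⁻¹ • z)).left ≫ ((Motives.baseChange L E).obj (S.M.obj K)).hom =
      Spec.map (CommRingCat.ofHom (algebraMap E ℂ)) := by
    rw [thickeningLift_left]
    change pullback.lift _ _ _ ≫ pullback.snd (S.M.obj K).hom (bcSpec L E) = _
    rw [pullback.lift_snd]
    have hco : (eT : E →+* ℂ) = algebraMap E ℂ := RingHom.ext fun x => heT x
    rw [hco]
  have hflat : (σL⁻¹ • z).left = (AlgPoints.mk (thickeningLift eT (S.M.obj K) (σL⁻¹ • z)).left hw₀ :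
      ComplexPoints ((Motives.baseChange L E).obj (S.M.obj K))).left ≫ pullback.fst (S.M.obj K).hom (bcSpec L E) := by
    change (σL⁻¹ • z).left = (thickeningLift eT (S.M.obj K) (σL⁻¹ • z)).left ≫ pullback.fst (S.M.obj K).hom (bcSpec L E)
    rw [thickeningLift_left]
    erw [pullback.lift_fst]
  have hread := hε (AlgPoints.mk (thickeningLift eT (S.M.obj K) (σL⁻¹ • z)).left hw₀) (σL⁻¹ • z) hflat
  rw [AlgPoints.map_apply, Over.comp_left, Category.assoc] at hread; rw [AlgPoints.smul_left]
  exact (congrArg (fun t => Spec.map (CommRingCat.ofHom σL.toAlgHom.toRingHom) ≫ t) hread).trans rfl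

end Sheet

/-! ### §5 HEAD — the classifying point of the slice at `ℓ_{eT∘γ}(z)` IS `f₂ (pts z)`, for every complex point `z` -/

section Head

variable (S : RecordSystemGS L Jstar τ K₀) (K : C5.SmallLevel K₀) (M : SchemeOver ℚ)
  (f : ShimuraSetGS L Jstar τ K.1.1 → ComplexPoints M)

set_option maxHeartbeats 800000 in -- large adelic ∕ Shimura-set terms: instance-heavy statements
/-- **HEAD — THE GLOBAL POINT LAW ON THE TWISTED SHEET.**  With the data of THEOREM A (from the `E`-slice `ε`, `hε`) and THEOREM B (`eT` the `L`-algebra form of `τE`,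
`σL` lifting `γ`): at EVERY complex point `z` of `M_K`, **`ℓ_{eT∘γ}(z) ≫ ε ≫ pr₁ = (f₂ (pts z)).left`** — the classifying point of the slice at the `γ`-twisted sheet point
over `z` is `f₂ [v, aK]` (`[v, aK] = pts z`).  USE (hodgecm `stub_SHEET`, road B′): `f := C.f`, `f₂ :=` the twisted chart map with shadow `[J v, b(a)·ũ_V(1,t)]`
(★ `UnitaryCurveSiegelPointMapTwisted`, continuity ★ p850443), `(s, d, hfw)` from ★ p849999 at the junction՚s correspondent — the «classified by THAT point» input of ADM ⇒ ISO.
[cite: Milne2005ShimuraVarieties, Lemma 13.5 and Thm. 13.6 (proof) p. 118; Def. 12.8 (62) p. 114] [cite: Shimura1998, §18.6 (pp. 124–128)] [cite: RapoportSmithlingZhang2020Diagonal, §3.2 p. 11] -/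
theorem RecordSystemGS.thickeningLift_comp_slice_fst_eq_fTwo [IsSeparated M.hom]
    (hJ : (Jstar.map (IsCMField.complexConj L))ᵀ = Jstar) (hdet : IsUnit Jstar.det)
    {E : Type} [Field E] [NumberField E] [Algebra L E] (τE : E →+* ℂ) (hτ : τE.comp (algebraMap L E) = τ)
    (ε : (Motives.baseChange L E).obj (S.M.obj K) ⟶ (Motives.baseChange ℚ E).obj M)
    (hε : letI : Algebra E ℂ := τE.toAlgebra
      ∀ (P : ComplexPoints ((Motives.baseChange L E).obj (S.M.obj K)))
        (Pflat : letI : Algebra L ℂ := τ.toAlgebra; ComplexPoints (S.M.obj K)),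
        Pflat.left = P.left ≫ pullback.fst (S.M.obj K).hom (bcSpec L E) →
        (AlgPoints.map ε P).left ≫ pullback.fst M.hom (bcSpec ℚ E) =
          (letI : Algebra L ℂ := τ.toAlgebra; (f (S.pts K Pflat)).left))
    (eT : letI : Algebra L ℂ := τ.toAlgebra; E →ₐ[L] ℂ) (heT : ∀ x : E, eT x = τE x)
    (σL : letI : Algebra L ℂ := τ.toAlgebra; ℂ ≃ₐ[L] ℂ) (γ : E →ₐ[L] E) (hσγ : ∀ x : E, σL (τE x) = τE (γ x))
    {w : Fin 2 → L} (hw : (fun i => τ (w i)) ∈ negCone (Jstar.map τ)) {s : (FiniteAdeleRing (𝓞 L) L)ˣ}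
    (hs : letI : Algebra L ℂ := τ.toAlgebra; IsArtinCorrespondent L τ s σL.toRingEquiv)
    {d : ↥(finAdelic (↥(maximalRealSubfield L)) L (IsCMField.complexConj L) 2 Jstar)}
    (hd : IsDiagTwistGS L Jstar w (recipFactor L s) d)
    (f₂ : ShimuraSetGS L Jstar τ K.1.1 → ComplexPoints M)
    (hf₂ : ∀ a : ↥(finAdelic (↥(maximalRealSubfield L)) L (IsCMField.complexConj L) 2 Jstar),
      Continuous fun x : ↥(negCone (Jstar.map τ)) => f₂ (ShimuraSetGS.mk L Jstar τ K.1.1 (x : Fin 2 → ℂ) x.2 a))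
    (hfw : letI : Algebra L ℂ := τ.toAlgebra
      ∀ a : ↥(finAdelic (↥(maximalRealSubfield L)) L (IsCMField.complexConj L) 2 Jstar),
        (σL.restrictScalars ℚ) • f (ShimuraSetGS.mk L Jstar τ K.1.1 (fun i => τ (w i)) hw a) =
          f₂ (ShimuraSetGS.mk L Jstar τ K.1.1 (fun i => τ (w i)) hw (d * a)))
    (z : letI : Algebra L ℂ := τ.toAlgebra; ComplexPoints (S.M.obj K)) :
    letI : Algebra L ℂ := τ.toAlgebra
    (thickeningLift (eT.comp γ) (S.M.obj K) z).left ≫ ε.left ≫ pullback.fst M.hom (bcSpec ℚ E) = (f₂ (S.pts K z)).left := by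
  letI iL : Algebra L ℂ := τ.toAlgebra
  rw [S.thickeningLift_comp_slice_fst_eq_smul K M f τE ε hε eT heT σL γ hσγ z]
  exact congrArg (fun Q : ComplexPoints M => Q.left)
    (S.smul_map_pts_eq_fTwo_of_forward_recip_of_slice K M f hJ hdet τE hτ ε hε σL hw hs hd f₂ hf₂ hfw z)

end Head



end UnitaryCanonicalModel

end Literature.AlgebraicGeometry.ShimuraVarieties

end
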